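import Mathlib
import Summits.PneNP.PneNP.Theorems.OverlapGapAlgebraSolvableImpliesStableSectionDensityLiftPath

/-!
# PneNP / OverlapGapAlgebra — crux `SolvableImpliesStableSection` (stmt-PneNP-2463):
# the DENSITY LIFT block (3/4) — the lifted section at fixed `k, m' ≤ m, n`

Support for crux `stmt-PneNP-2463` (`Summit.PneNP.PneNP.Theses.OverlapGapAlgebra.SolvableImpliesStableSection`).
THE LIFT.  Given any map `G` on instances with `m'` clauses, the lifted map `g Φ := G (first m' clauses
of Φ)` on instances with `m ≥ m'` clauses realises the Bresler–Huang path event (validity `≤ V` at all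
splice points, moves `≤ H` between consecutive splice points) on at least
`(ε - k(mk+1)·exp(-t²/(2(m-m'))))·#paths` path tuples, whenever `G` realises it at level `(V', H)` on
`≥ ε·#paths'` and `V ≥ V' + 1 + 2^{-k}(m - m') + t` (`sissDL_count`).  Mechanism: restricting every
instance of a path tuple to its first `m'` clauses commutes with splicing LITERALLY (same splice
formula), so head validity and stability are those of `G`; past the head the lifted section is
constant; the `m - m'` tail clauses of a splice point are, apart from at most one straddling clause,
whole clauses of the tuple not read by `g`, so the conditional Hoeffding bound applies at each of the
`k(mk+1)` splice points (`sissDL_card_bad_le`), and a head-good tuple off these tail events is good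
(`sissDL_viol_le`); the head-good tuples are `#good'·#paths/#paths'` (`sissDL_card_headGood`).

* `sissDL_count` — the lift at fixed `k, m' ≤ m, n` (registered).
No definitions; axioms `propext`, `Classical.choice`, `Quot.sound`.
-/

set_option linter.dupNamespace false -- `Summit.PneNP.PneNP.…`: summit = sub-problem (D-0017)

namespace Summit.PneNP.PneNP.Theorems

open Finset
open scoped Classical

section DensityLiftCount

/-- **The density lift at fixed `k, m' ≤ m, n`.** Let `G` be any map on `m'`-clause instances and
`g Φ := G (first m' clauses of Φ)` its lift to `m`-clause instances.  If `G` is `V'`-valid at every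
splice point and moves by `≤ H` between consecutive splice points on at least `ε·#paths'` of the path
tuples with `m'` clauses, then `g` is `V`-valid at every splice point and moves by `≤ H` between
consecutive splice points on at least `(ε - k(mk+1)·e^{-t²/(2(m-m'))})·#paths` of the path tuples with
`m` clauses, for every `V ≥ V' + 1 + 2^{-k}(m - m') + t`, `t > 0` (`n ≥ 1`). -/
theorem sissDL_count {k m m' n : ℕ} (hm : m' ≤ m) (hn : 1 ≤ n) (V' V H t ε : ℝ) (hH : 0 ≤ H) (ht : 0 < t)
    (hV : V' + 1 + (n : ℝ) ^ k / (2 * (n : ℝ)) ^ k * ((m - m' : ℕ) : ℝ) + t ≤ V)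
    (G : (Fin m' → Fin k → Fin n × Bool) → (Fin n → Bool))
    (g : (Fin m → Fin k → Fin n × Bool) → (Fin n → Bool))
    (hg : ∀ Φ, g Φ = G (fun a' => Φ (Fin.castLE hm a')))
    (hG : ε * Fintype.card (Fin (k + 1) → Fin m' → Fin k → Fin n × Bool) ≤
      ((Finset.univ.filter fun Ψ' : Fin (k + 1) → Fin m' → Fin k → Fin n × Bool =>
          let P : Fin k → ℕ → Fin m' → Fin k → Fin n × Bool :=
            fun r q a b => if (a : ℕ) * k + b < q then Ψ' r.succ a b else Ψ' r.castSucc a b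
          (∀ r : Fin k, ∀ q ≤ m' * k, ((Finset.univ.filter fun i : Fin m' =>
            ∀ j : Fin k, G (P r q) (P r q i j).1 ≠ (P r q i j).2).card : ℝ) ≤ V') ∧
          ∀ r : Fin k, ∀ q < m' * k,
            (hammingDist (G (P r q)) (G (P r (q + 1))) : ℝ) ≤ H).card : ℝ)) :
    (ε - k * (m * k + 1) * Real.exp (-(t ^ 2 / (2 * ((m - m' : ℕ) : ℝ))))) *
        Fintype.card (Fin (k + 1) → Fin m → Fin k → Fin n × Bool) ≤
      ((Finset.univ.filter fun Ψ : Fin (k + 1) → Fin m → Fin k → Fin n × Bool =>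
          let P : Fin k → ℕ → Fin m → Fin k → Fin n × Bool :=
            fun r q a b => if (a : ℕ) * k + b < q then Ψ r.succ a b else Ψ r.castSucc a b
          (∀ r : Fin k, ∀ q ≤ m * k, ((Finset.univ.filter fun i : Fin m =>
            ∀ j : Fin k, g (P r q) (P r q i j).1 ≠ (P r q i j).2).card : ℝ) ≤ V) ∧
          ∀ r : Fin k, ∀ q < m * k,
            (hammingDist (g (P r q)) (g (P r (q + 1))) : ℝ) ≤ H).card : ℝ) := by
  set p : ℝ := (n : ℝ) ^ k / (2 * (n : ℝ)) ^ k with hp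
  set Good' := (Finset.univ.filter fun Ψ' : Fin (k + 1) → Fin m' → Fin k → Fin n × Bool =>
          let P : Fin k → ℕ → Fin m' → Fin k → Fin n × Bool :=
            fun r q a b => if (a : ℕ) * k + b < q then Ψ' r.succ a b else Ψ' r.castSucc a b
          (∀ r : Fin k, ∀ q ≤ m' * k, ((Finset.univ.filter fun i : Fin m' =>
            ∀ j : Fin k, G (P r q) (P r q i j).1 ≠ (P r q i j).2).card : ℝ) ≤ V') ∧
          ∀ r : Fin k, ∀ q < m' * k,
            (hammingDist (G (P r q)) (G (P r (q + 1))) : ℝ) ≤ H) with hGood'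
  set Good := (Finset.univ.filter fun Ψ : Fin (k + 1) → Fin m → Fin k → Fin n × Bool =>
          let P : Fin k → ℕ → Fin m → Fin k → Fin n × Bool :=
            fun r q a b => if (a : ℕ) * k + b < q then Ψ r.succ a b else Ψ r.castSucc a b
          (∀ r : Fin k, ∀ q ≤ m * k, ((Finset.univ.filter fun i : Fin m =>
            ∀ j : Fin k, g (P r q) (P r q i j).1 ≠ (P r q i j).2).card : ℝ) ≤ V) ∧
          ∀ r : Fin k, ∀ q < m * k,
            (hammingDist (g (P r q)) (g (P r (q + 1))) : ℝ) ≤ H) with hGood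
  set HeadGood := (univ : Finset (Fin (k + 1) → Fin m → Fin k → Fin n × Bool)).filter fun Ψ =>
      (fun ρ a' => Ψ ρ (Fin.castLE hm a')) ∈ Good' with hHG
  set Bad : Fin k → ℕ → Finset (Fin (k + 1) → Fin m → Fin k → Fin n × Bool) := fun r q =>
      (univ : Finset (Fin (k + 1) → Fin m → Fin k → Fin n × Bool)).filter fun Ψ =>
        p * ((univ : Finset (Fin m)).filter fun a : Fin m =>
              m' ≤ (a : ℕ) ∧ (((a : ℕ) + 1) * k ≤ q ∨ q ≤ (a : ℕ) * k)).card + t ≤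
          ((((univ : Finset (Fin m)).filter fun a : Fin m =>
              m' ≤ (a : ℕ) ∧ (((a : ℕ) + 1) * k ≤ q ∨ q ≤ (a : ℕ) * k)).filter fun a : Fin m =>
            ∀ b : Fin k, G (fun (a' : Fin m') (b : Fin k) => if (a' : ℕ) * k + b < q
                then Ψ r.succ (Fin.castLE hm a') b else Ψ r.castSucc (Fin.castLE hm a') b)
              ((Ψ (if ((a : ℕ) + 1) * k ≤ q then r.succ else r.castSucc) a b).1) ≠
              (Ψ (if ((a : ℕ) + 1) * k ≤ q then r.succ else r.castSucc) a b).2).card : ℝ)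
    with hBad
  set U := (univ : Finset (Fin k)).biUnion fun r => (range (m * k + 1)).biUnion fun q => Bad r q
    with hU
  -- (1) a head-good tuple off the tail events is good
  have hincl : HeadGood ⊆ Good ∪ U := by
    intro Ψ hΨ
    rw [hHG, mem_filter] at hΨ
    have hΨ' := hΨ.2
    rw [hGood', mem_filter] at hΨ'
    obtain ⟨hval', hstab'⟩ := hΨ'.2
    by_cases hU' : Ψ ∈ U
    · exact mem_union_right _ hU'
    refine mem_union_left _ ?_
    have hnotbad : ∀ r : Fin k, ∀ q, q ≤ m * k → Ψ ∉ Bad r q := by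
      intro r q hq hmem
      refine hU' ?_
      rw [hU, mem_biUnion]
      exact ⟨r, mem_univ _, mem_biUnion.2 ⟨q, mem_range.2 (by omega), hmem⟩⟩
    -- the head at a splice point past the head is the head of the later endpoint
    have hfill : ∀ r : Fin k, ∀ q, m' * k ≤ q →
        (fun (a' : Fin m') (b : Fin k) => if (a' : ℕ) * k + b < q
          then Ψ r.succ (Fin.castLE hm a') b else Ψ r.castSucc (Fin.castLE hm a') b) =
        (fun (a' : Fin m') (b : Fin k) => if (a' : ℕ) * k + b < m' * k
          then Ψ r.succ (Fin.castLE hm a') b else Ψ r.castSucc (Fin.castLE hm a') b) := by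
      intro r q hq
      rw [sissDL_head_splice_of_ge hm Ψ r q hq, sissDL_head_splice_of_ge hm Ψ r (m' * k) le_rfl]
    -- head validity at every splice point
    have hhead : ∀ r : Fin k, ∀ q, (((univ : Finset (Fin m')).filter fun i' : Fin m' => ∀ j : Fin k,
        G (fun (a' : Fin m') (b : Fin k) => if (a' : ℕ) * k + b < q
            then Ψ r.succ (Fin.castLE hm a') b else Ψ r.castSucc (Fin.castLE hm a') b)
          ((if (i' : ℕ) * k + j < q then Ψ r.succ (Fin.castLE hm i') j
            else Ψ r.castSucc (Fin.castLE hm i') j).1) ≠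
          (if (i' : ℕ) * k + j < q then Ψ r.succ (Fin.castLE hm i') j
            else Ψ r.castSucc (Fin.castLE hm i') j).2).card : ℝ) ≤ V' := by
      intro r q
      rcases le_or_gt q (m' * k) with hq' | hq'
      · exact hval' r q hq'
      · have h1 := hval' r (m' * k) le_rfl
        have e := hfill r q hq'.le
        have e' := congrArg (fun (F : Fin m' → Fin k → Fin n × Bool) =>
            (((univ : Finset (Fin m')).filter fun i' : Fin m' => ∀ j : Fin k,
              G F ((F i' j).1) ≠ (F i' j).2).card : ℝ)) e
        rw [e']
        exact h1
    rw [hGood, mem_filter]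
    refine ⟨mem_univ _, ?_, ?_⟩
    · intro r q hq
      have hnb := hnotbad r q hq
      rw [hBad, mem_filter, not_and] at hnb
      have hv := sissDL_viol_le hm V' t G Ψ r q (hhead r q) (hnb (mem_univ _))
      rw [hg]
      exact hv.trans hV
    · intro r q hq
      rw [hg, hg]
      rcases lt_or_ge q (m' * k) with hq' | hq'
      · exact hstab' r q hq'
      · have e1 := hfill r q hq'
        have e2 := hfill r (q + 1) (by omega)
        show (hammingDist
            (G (fun (a' : Fin m') (b : Fin k) => if (a' : ℕ) * k + b < q
              then Ψ r.succ (Fin.castLE hm a') b else Ψ r.castSucc (Fin.castLE hm a') b))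
            (G (fun (a' : Fin m') (b : Fin k) => if (a' : ℕ) * k + b < q + 1
              then Ψ r.succ (Fin.castLE hm a') b else Ψ r.castSucc (Fin.castLE hm a') b)) : ℝ) ≤ H
        rw [e1, e2, hammingDist_self, Nat.cast_zero]
        exact hH
  -- (2) counting: the head-good tuples
  have hPaths'pos : (0 : ℝ) < Fintype.card (Fin (k + 1) → Fin m' → Fin k → Fin n × Bool) := by
    haveI : Nonempty (Fin n × Bool) := ⟨(⟨0, hn⟩, true)⟩
    exact_mod_cast Fintype.card_pos
  have hHead : ε * (Fintype.card (Fin (k + 1) → Fin m → Fin k → Fin n × Bool) : ℝ) ≤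
      (HeadGood.card : ℝ) := by
    have h := sissDL_card_headGood (k := k) (n := n) hm Good'
    have hR : (HeadGood.card : ℝ) * Fintype.card (Fin (k + 1) → Fin m' → Fin k → Fin n × Bool) =
        Good'.card * Fintype.card (Fin (k + 1) → Fin m → Fin k → Fin n × Bool) := by
      exact_mod_cast h
    have h2 : ε * (Fintype.card (Fin (k + 1) → Fin m → Fin k → Fin n × Bool) : ℝ) *
        Fintype.card (Fin (k + 1) → Fin m' → Fin k → Fin n × Bool) ≤
        (HeadGood.card : ℝ) * Fintype.card (Fin (k + 1) → Fin m' → Fin k → Fin n × Bool) := by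
      rw [hR]
      calc ε * (Fintype.card (Fin (k + 1) → Fin m → Fin k → Fin n × Bool) : ℝ) *
            Fintype.card (Fin (k + 1) → Fin m' → Fin k → Fin n × Bool)
          = (ε * Fintype.card (Fin (k + 1) → Fin m' → Fin k → Fin n × Bool)) *
              Fintype.card (Fin (k + 1) → Fin m → Fin k → Fin n × Bool) := by ring
        _ ≤ (Good'.card : ℝ) * Fintype.card (Fin (k + 1) → Fin m → Fin k → Fin n × Bool) :=
            mul_le_mul_of_nonneg_right hG (Nat.cast_nonneg _)
    exact le_of_mul_le_mul_right h2 hPaths'pos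
  -- the tail events
  have hUle : (U.card : ℝ) ≤ k * (m * k + 1) * Real.exp (-(t ^ 2 / (2 * ((m - m' : ℕ) : ℝ)))) *
      Fintype.card (Fin (k + 1) → Fin m → Fin k → Fin n × Bool) := by
    have h1 : U.card ≤ ∑ r : Fin k, ∑ q ∈ range (m * k + 1), (Bad r q).card :=
      card_biUnion_le.trans (sum_le_sum fun r _ => card_biUnion_le)
    calc (U.card : ℝ) ≤ ∑ r : Fin k, ∑ q ∈ range (m * k + 1), ((Bad r q).card : ℝ) := by
          exact_mod_cast h1
      _ ≤ ∑ _r : Fin k, ∑ _q ∈ range (m * k + 1), Real.exp (-(t ^ 2 / (2 * ((m - m' : ℕ) : ℝ)))) *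
            Fintype.card (Fin (k + 1) → Fin m → Fin k → Fin n × Bool) :=
          sum_le_sum fun r _ => sum_le_sum fun q _ => sissDL_card_bad_le hm hn t ht G r q
      _ = k * (m * k + 1) * Real.exp (-(t ^ 2 / (2 * ((m - m' : ℕ) : ℝ)))) *
            Fintype.card (Fin (k + 1) → Fin m → Fin k → Fin n × Bool) := by
          rw [sum_const, sum_const, card_range, card_univ, Fintype.card_fin, nsmul_eq_mul, nsmul_eq_mul]
          push_cast
          ring
  have hfinal : (HeadGood.card : ℝ) ≤ Good.card + U.card := by
    exact_mod_cast (card_le_card hincl).trans (card_union_le _ _)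
  rw [sub_mul]
  linarith

end DensityLiftCount

end Summit.PneNP.PneNP.Theorems
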